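import Literature.NumberTheory.Irrationality.LaiYu2020.DenominatorSetProofs
import Literature.NumberTheory.Irrationality.VanDerPoorten1979.CentralBinomialSeries
import HarnessLib

/-!
# Lai–Yu 2020, Proposition 2.2 (3): the size of the zero set `𝓕_B` — proofs

Topic `Literature/NumberTheory/Irrationality/LaiYu2020`. Second companion ("Proofs") file of
`NumberOfIrrationalOddZetaValues.lean`, for L. Lai, P. Yu, *A note on the number of irrational odd
zeta values*, Compositio Math. **156** (2020) 1699–1717 = arXiv:1911.08458 [LaiYu2020], §2
Proposition 2.2, read on the page (arXiv text p. 4):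

> «(3) If `B` is larger than some absolute constant, then `|𝓕_B| ≤ B²`.»
> «Proof. … Since `|𝓕_B| = ∑_{b ∈ Ψ_B} φ(b)`, a summation by parts argument gives
> `|𝓕_B| = (½ ζ(2)ζ(3)/ζ(6) + o(1)) B²`. Now, `ζ(2)ζ(3)/ζ(6) = 1.94… < 2`, the third proposition
> follows.»

Part (1) is `card_denominatorSet` (PROVED, `DenominatorSetProofs.lean`), part (2) is
`div_mem_zeroSet` (PROVED in the statement file). Here part (3) and the two displayed steps of its
proof are PROVED (theorems only; no definitions, no named facts; sorry-free):

* `card_zeroSet` — `|𝓕_B| = ∑_{b ∈ Ψ_B} φ(b)` (the reduced fractions in `(0,1]` with denominator `b`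
  are `a/b`, `1 ≤ a ≤ b`, `gcd(a,b) = 1`, `φ(b)` of them);
* `sum_totient_eq_layerCake` — `∑_{b ∈ Ψ_N} φ(b) = ∑_{1 ≤ j ≤ N} (|Ψ_N| − |Ψ_{j−1}|)` (the
  summation by parts, in layer-cake form);
* `tendsto_card_zeroSet_div_sq` — **`|𝓕_B|/B² → A/2`**, `A = ζ(2)ζ(3)/ζ(6)` (from
  `|Ψ_x| = (A + o(1)) x`, `TotientValueCounting.tendsto_count_div`);
* `density_lt_two` — `ζ(2)ζ(3)/ζ(6) < 2` (numerically: `ζ(6) ≥ 1`, `ζ(2) = π²/6 < 1.645`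
  (`π < 3.1416`), `ζ(3) < 1.2026` from the tree's van der Poorten series truncation
  `VanDerPoorten1979.abs_zetaValue_three_sub_partialSum_le`);
* `card_zeroSet_le_sq` — **Proposition 2.2 (3)**: `|𝓕_B| ≤ B²` for all large `B`.

## References

* [LaiYu2020] L. Lai, P. Yu, Compositio Math. 156 (2020) 1699–1717, §2 Prop. 2.2 (3) and its proof.
-/

noncomputable section

open Filter Topology Finset
open Literature.NumberTheory.Multiplicative.TotientValueCounting

namespace Literature.NumberTheory.Irrationality.LaiYu2020

open Literature.NumberTheory.Transcendental (zetaValue ofReal_zetaValue)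

/-! ### `|𝓕_B| = ∑_{b ∈ Ψ_B} φ(b)` -/

/-- `|𝓕_B| = ∑_{b ∈ Ψ_B} φ(b)`: the elements of `𝓕_B` with reduced denominator `b` are the `a/b` with
`1 ≤ a ≤ b`, `gcd(a, b) = 1`. [cite: LaiYu2020, proof of Prop. 2.2] -/
theorem card_zeroSet (B : ℝ) :
    (zeroSet B).ncard = ∑ b ∈ (denominatorSet_finite B).toFinset, Nat.totient b := by
  classical
  set T := (denominatorSet_finite B).toFinset with hT
  -- the parametrising finset of pairs `(b, a)`
  set P : Finset (Σ _ : ℕ, ℕ) := T.sigma fun b => (Ico 1 (1 + b)).filter (Nat.Coprime b) with hP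
  set f : (Σ _ : ℕ, ℕ) → ℚ := fun x => (x.2 : ℚ) / x.1 with hf
  have hmemT : ∀ {b : ℕ}, b ∈ T ↔ b ∈ denominatorSet B := fun {b} => by
    rw [hT, Set.Finite.mem_toFinset]
  -- `f` is injective on `P`
  have hden : ∀ x ∈ P, (f x).den = x.1 ∧ (f x).num = x.2 := by
    rintro ⟨b, a⟩ hx
    simp only [hP, mem_sigma, mem_filter, mem_Ico] at hx
    obtain ⟨hb, ⟨ha1, hab⟩, hcop⟩ := hx
    have hb0 : 0 < b := (hmemT.1 hb).1
    have hcop' : Nat.Coprime (a : ℤ).natAbs (b : ℤ).natAbs := by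
      simpa [Int.natAbs_natCast] using hcop.symm
    have h1 := Rat.den_div_eq_of_coprime (a := a) (b := b) (by exact_mod_cast hb0) hcop'
    have h2 := Rat.num_div_eq_of_coprime (a := a) (b := b) (by exact_mod_cast hb0) hcop'
    refine ⟨?_, ?_⟩
    · have : (((f ⟨b, a⟩).den : ℤ)) = b := by simpa [hf] using h1
      exact_mod_cast this
    · simpa [hf] using h2
  have hinj : Set.InjOn f ↑P := by
    intro x hx y hy hxy
    obtain ⟨hx1, hx2⟩ := hden x hx
    obtain ⟨hy1, hy2⟩ := hden y hy
    rw [hxy] at hx1 hx2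
    have h1 : x.1 = y.1 := by rw [← hx1, hy1]
    have h2 : x.2 = y.2 := by
      have : (x.2 : ℤ) = y.2 := by rw [← hx2, hy2]
      exact_mod_cast this
    rw [Sigma.ext_iff]
    exact ⟨h1, heq_of_eq h2⟩
  -- the image is `𝓕_B`
  have himage : (P.image f : Set ℚ) = zeroSet B := by
    ext θ
    simp only [coe_image, Set.mem_image, mem_coe]
    constructor
    · rintro ⟨x, hx, rfl⟩
      obtain ⟨hd, hn⟩ := hden x hx
      simp only [hP, mem_sigma, mem_filter, mem_Ico] at hx
      obtain ⟨hb, ⟨ha1, hab⟩, hcop⟩ := hx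
      have hb0 : (0 : ℚ) < x.1 := by exact_mod_cast (hmemT.1 hb).1
      refine ⟨?_, ?_, ?_⟩
      · exact div_pos (by exact_mod_cast ha1) hb0
      · rw [hf]
        rw [div_le_one hb0]
        exact_mod_cast (by omega : x.2 ≤ x.1)
      · rw [hd]
        exact hmemT.1 hb
    · rintro ⟨hpos, hle, hdenB⟩
      refine ⟨⟨θ.den, θ.num.toNat⟩, ?_, ?_⟩
      · simp only [hP, mem_sigma, mem_filter, mem_Ico]
        have hnum : 0 < θ.num := Rat.num_pos.2 hpos
        have hnumden : θ.num ≤ θ.den := by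
          have h := Rat.num_div_den θ
          have hd : (0 : ℚ) < θ.den := by exact_mod_cast θ.pos
          have : (θ.num : ℚ) ≤ θ.den := by
            rw [← h, div_le_one hd] at hle
            exact hle
          exact_mod_cast this
        refine ⟨hmemT.2 hdenB, ⟨by omega, by omega⟩, ?_⟩
        have := θ.reduced
        rw [Nat.Coprime, Nat.gcd_comm] at this
        rwa [Nat.Coprime, show θ.num.toNat = θ.num.natAbs by omega]
      · rw [hf]
        simp only
        have hnum : 0 ≤ θ.num := (Rat.num_pos.2 hpos).le
        rw [show ((θ.num.toNat : ℕ) : ℚ) = (θ.num : ℚ) by exact_mod_cast Int.toNat_of_nonneg hnum]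
        exact Rat.num_div_den θ
  rw [← himage, Set.ncard_coe_finset, card_image_of_injOn hinj, hP, card_sigma]
  refine sum_congr rfl fun b _ => ?_
  exact Nat.filter_coprime_Ico_eq_totient b 1

/-! ### The summation by parts (layer-cake form) -/

/-- `Ψ_M` as a `Finset`: membership. [folklore] -/
private theorem mem_levelSet {M k : ℕ} :
    k ∈ (finite_count_set ((M : ℕ) : ℝ)).toFinset ↔ 0 < k ∧ Nat.totient k ≤ M := by
  rw [Set.Finite.mem_toFinset, Set.mem_setOf_eq, Nat.cast_le]

/-- [folklore] -/
private theorem card_levelSet (M : ℕ) :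
    ((finite_count_set ((M : ℕ) : ℝ)).toFinset).card = count M := by
  rw [count, Set.ncard_eq_toFinset_card _ (finite_count_set (M : ℝ))]

/-- [folklore] -/
private theorem levelSet_mono {a M : ℕ} (h : a ≤ M) :
    (finite_count_set ((a : ℕ) : ℝ)).toFinset ⊆ (finite_count_set ((M : ℕ) : ℝ)).toFinset :=
  fun k hk => by
    rw [mem_levelSet] at hk ⊢
    exact ⟨hk.1, hk.2.trans h⟩

/-- `Ψ_B = Ψ_{⌊B⌋}` as finsets of the statement file (`B ≥ 0`). [folklore] -/
private theorem toFinset_denominatorSet_eq (B : ℝ) (hB : 0 ≤ B) :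
    (denominatorSet_finite B).toFinset = (finite_count_set ((⌊B⌋₊ : ℕ) : ℝ)).toFinset := by
  ext k
  rw [Set.Finite.mem_toFinset, mem_levelSet, mem_denominatorSet, Nat.le_floor_iff hB]

/-- **Summation by parts, layer-cake form**: `∑_{b ∈ Ψ_N} φ(b) = ∑_{1 ≤ j ≤ N} (|Ψ_N| − |Ψ_{j−1}|)`
(each `b ∈ Ψ_N` is counted once for every `j ≤ φ(b)`). [cite: LaiYu2020, proof of Prop. 2.2] -/
theorem sum_totient_eq_layerCake (N : ℕ) :
    ∑ b ∈ (finite_count_set ((N : ℕ) : ℝ)).toFinset, Nat.totient b =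
      ∑ j ∈ Icc 1 N, (count N - count (j - 1 : ℕ)) := by
  classical
  set T := (finite_count_set ((N : ℕ) : ℝ)).toFinset with hT
  -- `φ(b) = #{j ∈ [1, N] : j ≤ φ(b)}` for `b ∈ Ψ_N`
  have hphi : ∀ b ∈ T, Nat.totient b = ∑ j ∈ Icc 1 N, if j ≤ Nat.totient b then 1 else 0 := by
    intro b hb
    rw [hT, mem_levelSet] at hb
    rw [Finset.sum_boole, Nat.cast_id]
    have : (Icc 1 N).filter (fun j => j ≤ Nat.totient b) = Icc 1 (Nat.totient b) := by
      ext j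
      simp only [mem_filter, mem_Icc]
      omega
    rw [this, Nat.card_Icc]
    omega
  rw [sum_congr rfl hphi, sum_comm]
  refine sum_congr rfl fun j hj => ?_
  rw [mem_Icc] at hj
  rw [Finset.sum_boole, Nat.cast_id]
  have hsub := levelSet_mono (a := j - 1) (M := N) (by omega)
  rw [← card_levelSet, ← card_levelSet, ← card_sdiff_of_subset hsub]
  congr 1
  ext k
  simp only [mem_filter, Finset.mem_sdiff, hT, mem_levelSet, not_and, not_le]
  constructor
  · rintro ⟨⟨hk0, hkN⟩, hjk⟩
    exact ⟨⟨hk0, hkN⟩, fun _ => by omega⟩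
  · rintro ⟨⟨hk0, hkN⟩, h⟩
    exact ⟨⟨hk0, hkN⟩, by have := h hk0; omega⟩

/-- [folklore] -/
private theorem sum_Icc_sub_one (N : ℕ) : ∑ j ∈ Icc 1 N, ((j : ℝ) - 1) = ((N : ℝ) ^ 2 - N) / 2 := by
  induction N with
  | zero => simp
  | succ n ih =>
    rw [Finset.sum_Icc_succ_top (by omega), ih]
    push_cast
    ring

/-- Two-sided estimate of `∑_{b ∈ Ψ_N} φ(b)` along the integers: for every `η > 0`, eventually
`(A/2 − η) N² ≤ ∑_{b ∈ Ψ_N} φ(b) ≤ (A/2 + η) N²`. [cite: LaiYu2020, proof of Prop. 2.2] -/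
theorem sum_totient_bounds {η : ℝ} (hη : 0 < η) :
    ∃ N₀ : ℕ, ∀ N : ℕ, N₀ ≤ N →
      (density / 2 - η) * (N : ℝ) ^ 2 ≤
          ((∑ b ∈ (finite_count_set ((N : ℕ) : ℝ)).toFinset, Nat.totient b : ℕ) : ℝ) ∧
        ((∑ b ∈ (finite_count_set ((N : ℕ) : ℝ)).toFinset, Nat.totient b : ℕ) : ℝ) ≤
          (density / 2 + η) * (N : ℝ) ^ 2 := by
  have hA := density_pos
  -- linear bounds with accuracy `η/2`
  set η' : ℝ := min (η / 2) (density / 2) with hη'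
  have hη'pos : 0 < η' := lt_min (by linarith) (by linarith)
  have hη'le : η' ≤ η / 2 := min_le_left _ _
  have hη'A : η' ≤ density / 2 := min_le_right _ _
  obtain ⟨X₀, C₀, hX₀, hC₀, hlow, hup⟩ := count_linear_bounds hη'pos
  -- a lower bound valid for all `x ≥ 0`
  set C₁ : ℝ := (density - η') * X₀ with hC₁
  have hC₁nn : 0 ≤ C₁ := mul_nonneg (by linarith) (by linarith)
  have hlow' : ∀ x : ℝ, 0 ≤ x → (density - η') * x - C₁ ≤ count x := by
    intro x hx
    by_cases hxX : X₀ ≤ x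
    · have := hlow x hxX
      linarith
    · have h1 : (density - η') * x ≤ C₁ := by
        rw [hC₁]; exact mul_le_mul_of_nonneg_left (not_le.1 hxX).le (by linarith)
      have h2 : (0 : ℝ) ≤ count x := Nat.cast_nonneg _
      linarith
  -- choose `N₀` with `2 (C₀ + C₁ + A) N ≤ (η/2) N²`
  obtain ⟨N₀, hN₀⟩ : ∃ N₀ : ℕ, ∀ N : ℕ, N₀ ≤ N →
      X₀ ≤ (N : ℝ) ∧ 2 * (C₀ + C₁ + density) ≤ (η / 2) * N := by
    have h1 : ∀ᶠ N : ℕ in atTop, X₀ ≤ (N : ℝ) :=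
      tendsto_natCast_atTop_atTop.eventually_ge_atTop X₀
    have h2 : ∀ᶠ N : ℕ in atTop, 2 * (C₀ + C₁ + density) ≤ (η / 2) * N :=
      ((tendsto_natCast_atTop_atTop (R := ℝ)).const_mul_atTop (by linarith : (0:ℝ) < η / 2))
        |>.eventually_ge_atTop _
    obtain ⟨N₀, h⟩ := eventually_atTop.1 (h1.and h2)
    exact ⟨N₀, h⟩
  refine ⟨N₀, fun N hN => ?_⟩
  obtain ⟨hNX, hNC⟩ := hN₀ N hN
  have hN0 : (0 : ℝ) ≤ N := Nat.cast_nonneg _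
  -- the layer-cake identity, cast to `ℝ`
  have hlc := sum_totient_eq_layerCake N
  have hcast : ((∑ b ∈ (finite_count_set ((N : ℕ) : ℝ)).toFinset, Nat.totient b : ℕ) : ℝ) =
      ∑ j ∈ Icc 1 N, ((count N : ℝ) - count (j - 1 : ℕ)) := by
    rw [hlc, Nat.cast_sum]
    refine sum_congr rfl fun j hj => ?_
    rw [mem_Icc] at hj
    rw [Nat.cast_sub (count_mono (by exact_mod_cast (by omega : j - 1 ≤ N)))]
  rw [hcast]
  -- termwise bounds
  have hterm_up : ∀ j ∈ Icc 1 N, ((count N : ℝ) - count (j - 1 : ℕ)) ≤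
      ((density + η') * N + C₀ + C₁ + (density - η')) - (density - η') * (j : ℝ) := by
    intro j hj
    rw [mem_Icc] at hj
    have h1 := hup N
    have h2 := hlow' ((j - 1 : ℕ) : ℝ) (Nat.cast_nonneg _)
    have h3 : ((j - 1 : ℕ) : ℝ) = (j : ℝ) - 1 := by
      rw [Nat.cast_sub (by omega : 1 ≤ j), Nat.cast_one]
    have e : (density - η') * ((j - 1 : ℕ) : ℝ) = (density - η') * ((j : ℝ) - 1) := by rw [h3]
    rw [e] at h2
    linarith [h1, h2]
  have hterm_low : ∀ j ∈ Icc 1 N, ((density - η') * N - C₁ - C₀ + (density + η')) -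
      (density + η') * (j : ℝ) ≤ ((count N : ℝ) - count (j - 1 : ℕ)) := by
    intro j hj
    rw [mem_Icc] at hj
    have h1 := hlow' N hN0
    have h3 : ((j - 1 : ℕ) : ℝ) = (j : ℝ) - 1 := by
      rw [Nat.cast_sub (by omega : 1 ≤ j), Nat.cast_one]
    have e : (density + η') * ((j - 1 : ℕ) : ℝ) + C₀ = (density + η') * ((j : ℝ) - 1) + C₀ := by
      rw [h3]
    have h2 : (count ((j - 1 : ℕ) : ℝ) : ℝ) ≤ (density + η') * ((j : ℝ) - 1) + C₀ :=
      (hup (j - 1)).trans e.le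
    linarith
  have hsumj : ∑ j ∈ Icc 1 N, (j : ℝ) = ((N : ℝ) ^ 2 + N) / 2 := by
    have := sum_Icc_sub_one N
    rw [sum_sub_distrib, sum_const, Nat.card_Icc, nsmul_eq_mul] at this
    push_cast at this
    linarith
  have hP : (N : ℝ) * (2 * (C₀ + C₁ + density)) ≤ (N : ℝ) * ((η / 2) * N) :=
    mul_le_mul_of_nonneg_left hNC hN0
  have hQ : η' * (N : ℝ) ^ 2 ≤ (η / 2) * (N : ℝ) ^ 2 :=
    mul_le_mul_of_nonneg_right hη'le (sq_nonneg _)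
  have hR1 : 0 ≤ η' * (N : ℝ) := mul_nonneg hη'pos.le hN0
  have hR2 : 0 ≤ density * (N : ℝ) := mul_nonneg hA.le hN0
  have hR3 : 0 ≤ C₀ * (N : ℝ) := mul_nonneg hC₀ hN0
  have hR4 : 0 ≤ C₁ * (N : ℝ) := mul_nonneg hC₁nn hN0
  have hcard : ((Icc 1 N).card : ℝ) = N := by rw [Nat.card_Icc]; push_cast; ring
  constructor
  · refine le_trans ?_ (sum_le_sum hterm_low)
    rw [sum_sub_distrib, sum_const, nsmul_eq_mul, ← mul_sum, hsumj, hcard]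
    nlinarith [hP, hQ, hR1, hR2, hR3, hR4]
  · refine le_trans (sum_le_sum hterm_up) ?_
    rw [sum_sub_distrib, sum_const, nsmul_eq_mul, ← mul_sum, hsumj, hcard]
    nlinarith [hP, hQ, hR1, hR2, hR3, hR4]

/-- **`|𝓕_B| = (½ ζ(2)ζ(3)/ζ(6) + o(1)) B²`**: `|𝓕_B|/B² → A/2`.
[cite: LaiYu2020, proof of Prop. 2.2 (3)] -/
theorem tendsto_card_zeroSet_div_sq :
    Tendsto (fun B : ℝ => ((zeroSet B).ncard : ℝ) / B ^ 2) atTop (𝓝 (density / 2)) := by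
  -- along the integers
  have hnat : Tendsto (fun N : ℕ =>
      ((∑ b ∈ (finite_count_set ((N : ℕ) : ℝ)).toFinset, Nat.totient b : ℕ) : ℝ) / (N : ℝ) ^ 2)
      atTop (𝓝 (density / 2)) := by
    refine tendsto_order.2 ⟨fun a ha => ?_, fun a ha => ?_⟩
    · obtain ⟨N₀, hN₀⟩ := sum_totient_bounds (η := (density / 2 - a) / 2) (by linarith)
      filter_upwards [eventually_ge_atTop (max N₀ 1)] with N hN
      have hN1 : (1 : ℝ) ≤ N := by exact_mod_cast le_trans (le_max_right _ _) hN
      have h := (hN₀ N (le_trans (le_max_left _ _) hN)).1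
      rw [lt_div_iff₀ (by positivity)]
      have hpos : 0 < (density / 2 - a) / 2 * (N : ℝ) ^ 2 := mul_pos (by linarith) (by positivity)
      linarith
    · obtain ⟨N₀, hN₀⟩ := sum_totient_bounds (η := (a - density / 2) / 2) (by linarith)
      filter_upwards [eventually_ge_atTop (max N₀ 1)] with N hN
      have hN1 : (1 : ℝ) ≤ N := by exact_mod_cast le_trans (le_max_right _ _) hN
      have h := (hN₀ N (le_trans (le_max_left _ _) hN)).2
      rw [div_lt_iff₀ (by positivity)]
      have hpos : 0 < (a - density / 2) / 2 * (N : ℝ) ^ 2 := mul_pos (by linarith) (by positivity)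
      linarith
  -- pass to real `B` through `⌊B⌋`
  have h1 := hnat.comp (tendsto_nat_floor_atTop (α := ℝ))
  have h2 : Tendsto (fun x : ℝ => ((⌊x⌋₊ : ℝ) / x) ^ 2) atTop (𝓝 1) := by
    have := (tendsto_nat_floor_div_atTop (R := ℝ)).pow 2
    rwa [one_pow] at this
  have h := h1.mul h2
  rw [mul_one] at h
  refine h.congr' ?_
  filter_upwards [eventually_ge_atTop 1] with x hx
  have hx0 : 0 ≤ x := by linarith
  have hfl : (0 : ℝ) < ⌊x⌋₊ := by exact_mod_cast Nat.floor_pos.2 hx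
  simp only [Function.comp_apply]
  rw [card_zeroSet, toFinset_denominatorSet_eq x hx0]
  field_simp

/-! ### The numerical bound `ζ(2)ζ(3)/ζ(6) < 2` and Proposition 2.2 (3) -/

/-- `ζ(2) = π²/6`. [folklore] -/
private theorem zetaValue_two : zetaValue 2 = Real.pi ^ 2 / 6 := hasSum_zeta_two.tsum_eq

/-- `ζ(6) ≥ 1` (the term `n = 1`). [folklore] -/
private theorem one_le_zetaValue_six : 1 ≤ zetaValue 6 := by
  have hs : Summable fun n : ℕ => 1 / (n : ℝ) ^ 6 :=
    Real.summable_one_div_nat_pow.2 (by norm_num)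
  have h := hs.sum_le_tsum {1} (fun n _ => by positivity)
  simpa [zetaValue] using h

/-- `ζ(3) < 1.2026` (van der Poorten's series `ζ(3) = (5/2) ∑ (−1)^{n−1}/(n³ C(2n,n))`, truncated
after two terms: `ζ(3) ≤ 115/96 + 1/216`). [folklore] -/
private theorem zetaValue_three_lt : zetaValue 3 < 1.2026 := by
  have h := VanDerPoorten1979.abs_zetaValue_three_sub_partialSum_le 2
  have hb1 : VanDerPoorten1979.binomTerm 3 1 = 1 / 2 := by
    norm_num [VanDerPoorten1979.binomTerm, Nat.centralBinom, Nat.choose]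
  have hb2 : VanDerPoorten1979.binomTerm 3 2 = 1 / 48 := by
    norm_num [VanDerPoorten1979.binomTerm, Nat.centralBinom, Nat.choose]
  have hb3 : VanDerPoorten1979.binomTerm 3 3 = 1 / 540 := by
    norm_num [VanDerPoorten1979.binomTerm, Nat.centralBinom, Nat.choose]
  rw [Finset.sum_range_succ, Finset.sum_range_succ, Finset.sum_range_zero, hb3] at h
  simp only [zero_add, pow_zero, one_mul, pow_one, hb1, hb2] at h
  have := (abs_le.1 h).2
  norm_num at this ⊢
  linarith

/-- **`A = ζ(2)ζ(3)/ζ(6) = 1.94… < 2`**. [cite: LaiYu2020, proof of Prop. 2.2 (3)] -/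
theorem density_lt_two : density < 2 := by
  rw [density_eq_zetaValue]
  have h2 : zetaValue 2 < 1.645 := by
    rw [zetaValue_two]
    have := Real.pi_lt_d4
    have hpi : 0 < Real.pi := Real.pi_pos
    nlinarith
  have h3 := zetaValue_three_lt
  have h6 := one_le_zetaValue_six
  have h2pos : 0 < zetaValue 2 := by rw [zetaValue_two]; positivity
  have h3nn : 0 ≤ zetaValue 3 := tsum_nonneg fun n => by positivity
  calc zetaValue 2 * zetaValue 3 / zetaValue 6 ≤ zetaValue 2 * zetaValue 3 :=
        div_le_self (by positivity) h6
    _ < 1.645 * 1.2026 := by nlinarith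
    _ < 2 := by norm_num

/-- **Lai–Yu 2020, Proposition 2.2 (3)** (PROVED): "If `B` is larger than some absolute constant,
then `|𝓕_B| ≤ B²`." [cite: LaiYu2020, Prop. 2.2 (3)] -/
theorem card_zeroSet_le_sq : ∃ B₀ : ℝ, ∀ B : ℝ, B₀ ≤ B → ((zeroSet B).ncard : ℝ) ≤ B ^ 2 := by
  have hlt : density / 2 < 1 := by linarith [density_lt_two]
  have hev := (tendsto_card_zeroSet_div_sq.eventually (gt_mem_nhds hlt)).and
    (eventually_gt_atTop (0 : ℝ))
  obtain ⟨B₀, hB₀⟩ := eventually_atTop.1 hev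
  refine ⟨B₀, fun B hB => ?_⟩
  obtain ⟨h1, h2⟩ := hB₀ B hB
  rw [div_lt_iff₀ (by positivity)] at h1
  linarith

end Literature.NumberTheory.Irrationality.LaiYu2020

end
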